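import Literature.AlgebraicGeometry.Ramification.KatoCleanRamification
import Mathlib.RingTheory.UniqueFactorizationDomain.Basic
import Mathlib.Algebra.BigOperators.Associated
import HarnessLib

/-!
# Monomials `z^R = ∏ zᵢ^{Rᵢ}` in pairwise non-associated primes: divisors and exponents

Topic: `Literature/AlgebraicGeometry/Ramification` (support for
`RefinedSwanConductorIndependence.lean`, definition request `defn-KatoCleanRamification`).
Elementary algebra of the monomials `monomial z R = ∏ zᵢ^{Rᵢ}` of `KatoCleanRamification.lean`
(local equations of the divisor `R = Σ Rᵢ Dᵢ`): additivity in `R`, membership in the ideal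
`I_Z = (∏_{Rᵢ≠0} zᵢ)` of the wild support, and — in a unique factorisation domain with the `zᵢ`
prime — that divisors of `z^m` are unit multiples of monomials `z^s`, `s ≤ m`
(`exists_associated_monomial_of_dvd`) and that `z^a ∣ z^b` forces `a ≤ b` for pairwise
non-associated `zᵢ` (`le_of_monomial_dvd_monomial`). All [folklore].
-/

noncomputable section

namespace Literature.AlgebraicGeometry.Ramification

universe u

open IsLocalRing

/-! ## Monomials -/

section Monomial

variable {A : Type u} [CommRing A] {n : ℕ} (z : Fin n → A)

/-- `z^(R+S) = z^R z^S`. [folklore] -/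
theorem monomial_add (R S : Fin n → ℕ) : monomial z (R + S) = monomial z R * monomial z S := by
  simp only [monomial, Pi.add_apply, pow_add, Finset.prod_mul_distrib]

/-- `z^R = z^(R-S) z^S` for `S ≤ R`. [folklore] -/
theorem monomial_eq_mul_of_le {R S : Fin n → ℕ} (h : ∀ i, S i ≤ R i) :
    monomial z R = monomial z (R - S) * monomial z S := by
  rw [← monomial_add]
  congr 1
  funext i
  exact (Nat.sub_add_cancel (h i)).symm

/-- `z^(p•S) = (z^S)^p`. [folklore] -/
theorem monomial_nsmul (p : ℕ) (S : Fin n → ℕ) : monomial z (p • S) = monomial z S ^ p := by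
  rw [monomial, monomial, ← Finset.prod_pow]
  refine Finset.prod_congr rfl fun i _ => ?_
  rw [Pi.smul_apply, smul_eq_mul, mul_comm, pow_mul]

/-- `∏_{Rᵢ ≠ 0} zᵢ` divides `z^m` as soon as `mᵢ ≥ 1` whenever `Rᵢ ≠ 0`. [folklore] -/
theorem prod_filter_dvd_monomial (R m : Fin n → ℕ) (h : ∀ i, R i ≠ 0 → 1 ≤ m i) :
    (∏ i ∈ Finset.univ.filter (fun i => R i ≠ 0), z i) ∣ monomial z m := by
  rw [Finset.prod_filter, monomial]
  refine Finset.prod_dvd_prod_of_dvd _ _ fun i _ => ?_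
  split_ifs with hi
  · exact dvd_pow_self _ (Nat.one_le_iff_ne_zero.mp (h i hi))
  · exact one_dvd _

/-- Such a monomial lies in the ideal `I_Z` of the wild support. [folklore] -/
theorem monomial_mem_wildSupportIdeal (R m : Fin n → ℕ) (h : ∀ i, R i ≠ 0 → 1 ≤ m i) :
    monomial z m ∈ wildSupportIdeal z R :=
  Ideal.mem_span_singleton.mpr (prod_filter_dvd_monomial z R m h)

/-- If some `Rᵢ ≠ 0` and all `zᵢ ∈ 𝔪` then `I_Z ⊆ 𝔪`. [folklore] -/
theorem wildSupportIdeal_le_maximalIdeal [IsLocalRing A] (hz : ∀ i, z i ∈ maximalIdeal A)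
    {R : Fin n → ℕ} {i : Fin n} (hi : R i ≠ 0) : wildSupportIdeal z R ≤ maximalIdeal A := by
  classical
  rw [wildSupportIdeal, Ideal.span_le, Set.singleton_subset_iff, SetLike.mem_coe,
    ← Finset.mul_prod_erase _ _ (Finset.mem_filter.mpr ⟨Finset.mem_univ i, hi⟩)]
  exact Ideal.mul_mem_right _ _ (hz i)

end Monomial

/-! ## Divisors of monomials in a unique factorisation domain -/

section UFD

variable {A : Type u} [CommRing A] [IsDomain A] [UniqueFactorizationMonoid A] {n : ℕ}
  {z : Fin n → A}

/-- **Divisors of a monomial in primes are monomials up to units.** [folklore] -/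
theorem exists_associated_monomial_of_dvd (hz : ∀ i, Prime (z i)) (m : Fin n → ℕ)
    (S : Finset (Fin n)) :
    ∀ c : A, c ∣ ∏ i ∈ S, z i ^ m i →
      ∃ s : Fin n → ℕ, (∀ i, s i ≤ m i) ∧ Associated c (∏ i ∈ S, z i ^ s i) := by
  classical
  induction S using Finset.induction with
  | empty =>
    intro c hc
    refine ⟨0, fun i => Nat.zero_le _, ?_⟩
    simpa [associated_one_iff_isUnit, isUnit_iff_dvd_one] using hc
  | insert a S haS ih =>
    intro c hc
    rw [Finset.prod_insert haS] at hc
    obtain ⟨c₁, c₂, h₁, h₂, rfl⟩ := exists_dvd_and_dvd_of_dvd_mul hc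
    obtain ⟨k, hk, hk'⟩ := (dvd_prime_pow (hz a) _).mp h₁
    obtain ⟨s, hs, hs'⟩ := ih c₂ h₂
    refine ⟨Function.update s a k, fun i => ?_, ?_⟩
    · rcases eq_or_ne i a with rfl | hia
      · simpa using hk
      · simpa [Function.update_of_ne hia] using hs i
    · rw [Finset.prod_insert haS, Function.update_self]
      have e : ∏ i ∈ S, z i ^ Function.update s a k i = ∏ i ∈ S, z i ^ s i :=
        Finset.prod_congr rfl fun i hi => by rw [Function.update_of_ne (ne_of_mem_of_not_mem hi haS)]
      rw [e]
      exact hk'.mul_mul hs'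

omit [UniqueFactorizationMonoid A] in
/-- **Exponent comparison**: `z^a ∣ z^b` forces `a ≤ b` for pairwise non-associated primes `zᵢ`.
[folklore] -/
theorem le_of_monomial_dvd_monomial (hz : ∀ i, Prime (z i))
    (hza : ∀ i j, i ≠ j → ¬Associated (z i) (z j)) {a b : Fin n → ℕ}
    (h : monomial z a ∣ monomial z b) (i : Fin n) : a i ≤ b i := by
  classical
  have hi : z i ^ a i ∣ monomial z b :=
    (Finset.dvd_prod_of_mem (fun j => z j ^ a j) (Finset.mem_univ i)).trans h
  rw [monomial, ← Finset.mul_prod_erase _ _ (Finset.mem_univ i)] at hi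
  have hndvd : ¬z i ∣ ∏ j ∈ Finset.univ.erase i, z j ^ b j := by
    intro hd
    obtain ⟨j, hj, hij⟩ := ((hz i).dvd_finsetProd_iff _).mp hd
    exact hza i j (Finset.ne_of_mem_erase hj).symm
      ((hz i).associated_of_dvd (hz j) ((hz i).dvd_of_dvd_pow hij))
  exact (pow_dvd_pow_iff (hz i).ne_zero (hz i).not_unit).mp
    ((hz i).pow_dvd_of_dvd_mul_right (a i) hndvd hi)

end UFD

end Literature.AlgebraicGeometry.Ramification

end
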